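import Mathlib
import Summits.KontsevichZagierPeriods.KontsevichZagierPeriods.Theorems.SoloInformedParamComboI
import Summits.KontsevichZagierPeriods.KontsevichZagierPeriods.Theorems.SoloInformedRealParamBarrierBdd
import HarnessLib

/-!
# Solo-informed (A390-ii): coincidence clauses, constant terms and the class-function principle
for I-admissible denotations

File F6d — step 3 of the real-parameter kernel for arbitrary `KZ_ℝ` chains: the `repI`/`comboI`
versions of the tools of `SoloInformedParamCoin` and `SoloInformedParamClass`.  The coincidence
clause `SoloInformedCoin` is unchanged (it is a first-order condition on the families); what is
re-proved is its interaction with the I-admissible denotation: equal values (`valueI_eq_of_coin`),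
coincidence from equal denotations (`coin_of_repI_eq`), pinning (`repI_eq_of_coin_rigid`), the
constant term of an ARBITRARY `ℚ`-representation (`admI_const`, `repI_const` — no boundedness),
the rectangle term, transport along `d = d'`, the class-function principle for `comboI`, and the
congruence `[x] − [y] ∈ KZOver.relations k` for representations equal on their common domain.
-/

noncomputable section

open Set MeasureTheory MvPolynomial Literature.ModelTheory.ExponentialFields
  Literature.NumberTheory.Transcendental

namespace Summit.KontsevichZagierPeriods.KontsevichZagierPeriods.Theorems

/-! ### On-domain coincidence is a relation of the full calculus -/

/-- Representations with the same domain and integrands equal on it differ by a relation of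
`KZ_k` (two instances of move (1b) with the zero integrand). [cite: KontsevichZagier2001, §1.2] -/
theorem soloInformed_sub_mem_relations_of_eqOn {k : Type*} [Field k] [Algebra k ℝ] {n : ℕ}
    {x y : KZOver.IntegralRep k n} (hd : x.domain = y.domain)
    (hi : EqOn x.integrand y.integrand x.domain) :
    KZOver.of x - KZOver.of y ∈ KZOver.relations k := by
  have h1 : KZOver.of x - KZOver.of y - KZOver.of (soloInformedZeroRep x) ∈ KZOver.relations k := by
    refine KZOver.integrandAddRel_subset_relations ⟨n, x, y, soloInformedZeroRep x, hd.symm, rfl,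
      fun z hz => ?_, rfl⟩
    simp only [Pi.add_apply, soloInformedZeroRep, add_zero]
    exact hi hz
  have h2 : KZOver.of y - KZOver.of y - KZOver.of (soloInformedZeroRep x) ∈ KZOver.relations k := by
    refine KZOver.integrandAddRel_subset_relations ⟨n, y, y, soloInformedZeroRep x, rfl, hd,
      fun z _ => ?_, rfl⟩
    simp only [Pi.add_apply, soloInformedZeroRep, add_zero]
  have h := sub_mem h1 h2
  rwa [sub_self, zero_sub, sub_neg_eq_add, sub_add_cancel] at h

namespace SoloInformedPTerm

variable {K : Type} {d d' : ℕ} {T T' : SoloInformedPTerm K d} {p p₀ : K → ℝ}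

/-! ### Coincidence and the I-admissible denotation -/

/-- I-admissibility from a graph description by an integral representation.
[cite: KontsevichZagier2001, §1.1] -/
theorem admI_of_graph (r : KZOver.IntegralRep ℝ d) (hdom : r.domain = T.fibre p)
    (hgraph : ∀ x ∈ T.fibre p, ∀ t : ℝ, Fin.snoc x t ∈ T.gfibre p ↔ t = r.integrand x) :
    T.SoloInformedAdmI p := by
  have hf : T.SoloInformedFunctional p := fun x hx =>
    ⟨⟨r.integrand x, (hgraph x hx _).2 rfl⟩, fun t t' ht ht' => by
      rw [(hgraph x hx t).1 ht, (hgraph x hx t').1 ht']⟩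
  refine ⟨hf, ?_⟩
  have h : IntegrableOn r.integrand (T.fibre p) := hdom ▸ r.integrableOn
  exact h.congr_fun (fun x hx => (hybrid_eq_of_mem hf hx ((hgraph x hx _).2 rfl)).symm)
    (T.measurableSet_fibre p)

/-- **Coinciding I-admissible terms denote representations with the same domain and integrands
equal on it.** [cite: KontsevichZagier2001, §1.1] -/
theorem repI_congr_of_coin (h : T.SoloInformedCoin T' p) (hT : T.SoloInformedAdmI p)
    (hT' : T'.SoloInformedAdmI p) :
    (T.repI p).domain = (T'.repI p).domain ∧
      EqOn (T.repI p).integrand (T'.repI p).integrand (T.repI p).domain := by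
  rw [repI_domain hT, repI_domain hT', repI_integrand hT, repI_integrand hT']
  exact ⟨fibre_eq_of_coin h, hybrid_eqOn_of_coin h hT.1 hT'.1⟩

/-- Coinciding I-admissible terms denote representations with the same value.
[cite: KontsevichZagier2001, §1.1] -/
theorem valueI_eq_of_coin (h : T.SoloInformedCoin T' p) (hT : T.SoloInformedAdmI p)
    (hT' : T'.SoloInformedAdmI p) : (T.repI p).value = (T'.repI p).value :=
  soloInformed_value_congr (repI_congr_of_coin h hT hT').1 (repI_congr_of_coin h hT hT').2

/-- Coinciding I-admissible terms denote `KZ_ℝ`-equivalent representations.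
[cite: KontsevichZagier2001, §1.2] -/
theorem of_repI_sub_mem_of_coin (h : T.SoloInformedCoin T' p) (hT : T.SoloInformedAdmI p)
    (hT' : T'.SoloInformedAdmI p) :
    KZOver.of (T.repI p) - KZOver.of (T'.repI p) ∈ KZOver.relations ℝ :=
  soloInformed_sub_mem_relations_of_eqOn (repI_congr_of_coin h hT hT').1
    (repI_congr_of_coin h hT hT').2

/-- **Equal I-denotations force coincidence.** [cite: KontsevichZagier2001, §1.1] -/
theorem coin_of_repI_eq (hT : T.SoloInformedAdmI p) (hT' : T'.SoloInformedAdmI p)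
    (h : T.repI p = T'.repI p) : T.SoloInformedCoin T' p := by
  have hfib : T.fibre p = T'.fibre p := by rw [← repI_domain hT, ← repI_domain hT', h]
  refine ⟨fun x => by rw [hfib], fun z hz hzG => ?_⟩
  have hx' : Fin.init z ∈ T'.fibre p := hfib ▸ hz
  have h1 : T.gval p (Fin.init z) = z (Fin.last d) :=
    gval_eq hT.1 hz (t := z (Fin.last d)) (by rwa [Fin.snoc_init_self])
  have h2 : T.gval p (Fin.init z) = T'.gval p (Fin.init z) := by
    rw [← hybrid_of_mem hz, ← hybrid_of_mem hx', ← repI_integrand hT, ← repI_integrand hT', h]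
  have h3 := snoc_gval_mem hT'.1 hx'
  rwa [← h2, h1, Fin.snoc_init_self] at h3

/-- **One term at two parameters** (I-admissible): equal fibres and equal graph values force equal
denotations. [cite: KontsevichZagier2001, §1.1] -/
theorem repI_eq_repI_of_fibre_eq (h : T.SoloInformedAdmI p) (h₀ : T.SoloInformedAdmI p₀)
    (hfib : T.fibre p = T.fibre p₀) (hg : ∀ x ∈ T.fibre p, T.gval p x = T.gval p₀ x) :
    T.repI p = T.repI p₀ := by
  refine KZOver.IntegralRep.ext (by rw [repI_domain h, repI_domain h₀, hfib]) ?_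
  rw [repI_integrand h, repI_integrand h₀]
  funext x
  by_cases hx : x ∈ T.fibre p
  · rw [hybrid_of_mem hx, hybrid_of_mem (hfib ▸ hx), hg x hx]
  · rw [hybrid_of_not_mem hx, hybrid_of_not_mem (hfib ▸ hx)]

/-- **Pinning by a rigid term** (I-admissible). [cite: KontsevichZagier2001, §1.1] -/
theorem repI_eq_of_coin_rigid {C : SoloInformedPTerm K d} (hT : T.SoloInformedAdmI p)
    (hT₀ : T.SoloInformedAdmI p₀) (hC : C.SoloInformedAdmI p) (hC₀ : C.SoloInformedAdmI p₀)
    (hCfib : C.fibre p = C.fibre p₀) (hCg : ∀ x ∈ C.fibre p, C.gval p x = C.gval p₀ x)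
    (h₀ : T.repI p₀ = C.repI p₀) (h : T.SoloInformedCoin C p) : T.repI p = T.repI p₀ := by
  have hc₀ : T.SoloInformedCoin C p₀ := coin_of_repI_eq hT₀ hC₀ h₀
  have hfib : T.fibre p = T.fibre p₀ := by
    rw [fibre_eq_of_coin h, hCfib, ← fibre_eq_of_coin hc₀]
  refine repI_eq_repI_of_fibre_eq hT hT₀ hfib fun x hx => ?_
  have hxC : x ∈ C.fibre p := (h.1 x).1 hx
  rw [gval_eq_of_coin h hT.1 hC.1 hx, hCg x hxC, gval_eq_of_coin hc₀ hT₀.1 hC₀.1 (hfib ▸ hx)]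

/-! ### Transport along `d = d'` -/

/-- The transported term denotes the same generator. [cite: KontsevichZagier2001, §1.2] -/
theorem sigma_repI_castDim (h : d = d') (T : SoloInformedPTerm K d) (p : K → ℝ) :
    (⟨d', (castDim h T).repI p⟩ : Σ n, KZOver.IntegralRep ℝ n) = ⟨d, T.repI p⟩ := by
  subst h
  rfl

/-- Transport preserves I-admissibility. [cite: KontsevichZagier2001, §1.1] -/
theorem admI_castDim_iff (h : d = d') (T : SoloInformedPTerm K d) (p : K → ℝ) :
    (castDim h T).SoloInformedAdmI p ↔ T.SoloInformedAdmI p := by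
  subst h
  exact Iff.rfl

/-- Transport preserves the value of the I-denotation. [cite: KontsevichZagier2001, §1.1] -/
theorem value_repI_castDim (h : d = d') (T : SoloInformedPTerm K d) (p : K → ℝ) :
    ((castDim h T).repI p).value = (T.repI p).value := by
  subst h
  rfl

/-- Transported terms denote transported representations. [cite: KontsevichZagier2001, §1.1] -/
theorem repI_castDim (h : d = d') (T : SoloInformedPTerm K d) (p : K → ℝ) :
    (castDim h T).repI p = castRep h (T.repI p) := by
  subst h
  rfl

/-! ### Constant and rectangle terms -/

variable {n : ℕ} (r : KZOver.IntegralRep ℚ n) (q : K → ℝ)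

/-- The constant term of an ARBITRARY `ℚ`-representation is I-admissible everywhere.
[cite: KontsevichZagier2001, §1.1] -/
theorem admI_const : (const K r).SoloInformedAdmI q :=
  admI_of_graph (r.baseChange ℝ) (fibre_const r q).symm fun x hx t => by
    rw [fibre_const] at hx
    exact snoc_mem_gfibre_const r q hx t

/-- **The constant term denotes `r ⊗ ℝ` at every parameter.** [cite: KontsevichZagier2001, §1.1] -/
theorem repI_const : (const K r).repI q = r.baseChange ℝ :=
  repI_eq_of_graph _ (fibre_const r q).symm (fun x hx t => by
    rw [fibre_const] at hx
    exact snoc_mem_gfibre_const r q hx t) (fun _ _ => rfl)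

/-- **A term pinned to a constant term is frozen** (I-admissible).
[cite: KontsevichZagier2001, §1.1] -/
theorem repI_eq_of_coin_const {T : SoloInformedPTerm K n} (hT : T.SoloInformedAdmI p)
    (hT₀ : T.SoloInformedAdmI p₀) (h₀ : T.repI p₀ = r.baseChange ℝ)
    (h : T.SoloInformedCoin (const K r) p) : T.repI p = r.baseChange ℝ := by
  rw [← h₀]
  refine repI_eq_of_coin_rigid hT hT₀ (admI_const r p) (admI_const r p₀)
    (by rw [fibre_const, fibre_const]) (fun x hx => ?_) (by rw [h₀, repI_const r p₀]) h
  rw [fibre_const] at hx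
  rw [gval_const r p hx, gval_const r p₀ hx]

/-- **The rectangle term I-denotes the rectangle.** [cite: KontsevichZagier2001, §1.1] -/
theorem repI_rectTerm (kℓ : K) : (rectTerm kℓ).repI q = soloInformedRealRect (q kℓ) := by
  rw [repI_eq_rep (adm_rectTerm q kℓ), rep_rectTerm]

end SoloInformedPTerm

/-! ### The class-function principle for `comboI` -/

namespace SoloInformedPCombo

variable {K : Type} (P : SoloInformedPCombo K) (p : K → ℝ)

/-- The generator contributed by the term `t` at the parameter `p` (I-denotation).
[cite: KontsevichZagier2001, §1.2] -/
def keyI (t : P.ι) : Σ n, KZOver.IntegralRep ℝ n := ⟨P.dim t, (P.term t).repI p⟩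

/-- The denoted element as a combination of generator keys. [cite: KontsevichZagier2001, §1.2] -/
theorem comboI_eq_sum_keyI : P.comboI p = ∑ t, P.coef t • FreeAbelianGroup.of (P.keyI p t) := rfl

/-- **Additive maps on the denoted element.** [cite: KontsevichZagier2001, §1.2] -/
theorem lift_comboI {β : Type*} [AddCommGroup β] (w : (Σ n, KZOver.IntegralRep ℝ n) → β) :
    FreeAbelianGroup.lift w (P.comboI p) = ∑ t, P.coef t • w (P.keyI p t) := by
  rw [comboI_eq_sum_keyI, map_sum]
  simp only [map_zsmul, FreeAbelianGroup.lift_apply_of]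

/-- **Evaluation of the denoted element.** [cite: KontsevichZagier2001, §1.2] -/
theorem eval_comboI : KZOver.eval ℝ (P.comboI p) = ∑ t, P.coef t • ((P.term t).repI p).value := by
  unfold comboI
  rw [map_sum]
  simp only [map_zsmul, KZOver.eval_of]

/-- At a good parameter (the combination is a relation) the weighted values sum to zero.
[cite: KontsevichZagier2001, §1.2] -/
theorem sum_valueI_eq_zero (h : P.comboI p ∈ KZOver.relations ℝ) :
    ∑ t, P.coef t • ((P.term t).repI p).value = 0 := by
  rw [← eval_comboI]
  exact KZOver.eval_eq_zero_of_mem_relations h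

/-- **Class-function principle** for `comboI`. [cite: KontsevichZagier2001, §1.2] -/
theorem sum_eq_of_comboI_eq_sub {β : Type*} [AddCommGroup β] {n m : ℕ}
    {A : KZOver.IntegralRep ℝ n} {B : KZOver.IntegralRep ℝ m} {p₀ : K → ℝ}
    (hc : P.comboI p₀ = KZOver.of A - KZOver.of B)
    (hAB : (⟨n, A⟩ : Σ k, KZOver.IntegralRep ℝ k) ≠ ⟨m, B⟩) (u : P.ι → β) (a b : β)
    (hu : ∀ t t', P.keyI p₀ t = P.keyI p₀ t' → u t = u t')
    (ha : ∀ t, P.keyI p₀ t = ⟨n, A⟩ → u t = a) (hb : ∀ t, P.keyI p₀ t = ⟨m, B⟩ → u t = b) :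
    ∑ t, P.coef t • u t = a - b := by
  classical
  let w : (Σ k, KZOver.IntegralRep ℝ k) → β := fun x =>
    if x = ⟨n, A⟩ then a else if x = ⟨m, B⟩ then b else
      if h : ∃ t, P.keyI p₀ t = x then u h.choose else 0
  have hw : ∀ t, w (P.keyI p₀ t) = u t := by
    intro t
    simp only [w]
    split_ifs with h₁ h₂ h₃
    · exact (ha t h₁).symm
    · exact (hb t h₂).symm
    · exact hu _ _ h₃.choose_spec
    · exact absurd ⟨t, rfl⟩ h₃
  have hwA : w ⟨n, A⟩ = a := by simp only [w, if_pos rfl]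
  have hwB : w ⟨m, B⟩ = b := by
    have hne : (⟨m, B⟩ : Σ k, KZOver.IntegralRep ℝ k) ≠ ⟨n, A⟩ := fun h => hAB h.symm
    simp only [w, hne, if_false, if_true]
  have h1 : FreeAbelianGroup.lift w (P.comboI p₀) = ∑ t, P.coef t • u t := by
    rw [lift_comboI]
    simp only [hw]
  have h2 : FreeAbelianGroup.lift w (P.comboI p₀) = a - b := by
    rw [hc]
    show FreeAbelianGroup.lift w (FreeAbelianGroup.of ⟨n, A⟩ - FreeAbelianGroup.of ⟨m, B⟩) = a - b
    rw [map_sub, FreeAbelianGroup.lift_apply_of, FreeAbelianGroup.lift_apply_of, hwA, hwB]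
  exact h1.symm.trans h2

end SoloInformedPCombo

end Summit.KontsevichZagierPeriods.KontsevichZagierPeriods.Theorems
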